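import Summits.RiemannHypothesis.RiemannHypothesis.Theses.OddSector
import Summits.RiemannHypothesis.RiemannHypothesis.Theorems.RuelleBandExactFirstBandStubOddSectorCriterion
import Summits.RiemannHypothesis.RiemannHypothesis.Theorems.OddSectorOddOneSignedWindowsExistence
import Summits.RiemannHypothesis.RiemannHypothesis.Theorems.OddSectorOddOneSignedWindowsRealPart
import Literature.NumberTheory.LFunctions.WeilOddGroundState
import Literature.NumberTheory.LFunctions.WeilGroundEnergyParitySplit
import Literature.NumberTheory.LFunctions.YoshidaOddCriterion
import Literature.NumberTheory.LFunctions.WeilCriterionProofs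
import Literature.NumberTheory.LFunctions.ZetaRealAxis
import Literature.NumberTheory.LFunctions.GeneralizedRH
import HarnessLib

/-!
# Disproof of `OddBartaFloor` (stmt-RiemannHypothesis-17779, route OddSector, rank 3) — findings

Standing disprover `refuter-cdisprove-stmt-RiemannHypothesis-17779-0`, cycle 1 (2026-08-17).
Everything below is kernel-checked (no `sorry`); prose lives in docstrings only.

LANDED (importable; this work file keeps self-contained copies under the `Disproof` namespace):
* `Summits/RiemannHypothesis/RiemannHypothesis/Theorems/OddBartaFloor/Negative/OddBartaFloorLoadBearing.lean`
  (p145481, commit 57946e23075a; namespace `…Theorems.OddBartaFloor.Negative`): §§0–2 below with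
  every statement INLINE (no defs) — `floor_template_iff`, `oddBartaFloor_iff_oddOneSignedWindows_imp`,
  `not_oddBartaFloor_iff`, `oddBartaFloor_iff_signChange`, `oddBartaFloor_iff_eventually_goodWindow_imp`,
  `oddBartaFloor_without_{goodWindow,sign,nonneg,reality}_iff_riemannHypothesis`,
  `oddBartaFloor_without_decay`, `oddBartaFloor_all_windows_iff`, `oddBartaFloor_all_tests_iff`,
  `goodWindow_iff_real_oneSigned_either`, plus `oddPositivity_iff_riemannHypothesis` and the
  Summits-side discharge `yoshida_odd_criterion_holds : yoshida_odd_criterion`.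
* `…/Theorems/OddBartaFloor/Negative/OddBartaFloorBartaModels.lean` (p146355, commit 5cb3c4ed918b):
  §3 below (`barta_matrix`, `barta_false_without_sign`, `barta_false_without_everywhere`).

## Verdict: NO UNCONDITIONAL KILL EXISTS — `¬ OddBartaFloor ↔ (OddOneSignedWindows ∧ ¬ RH)`

The crux `C = OddBartaFloor` is, token for token, `FloorAt GoodWindow` (§0), and for EVERY window
predicate `P` the floor template satisfies (§1, `floorAt_iff`)

  `FloorAt P ↔ ((∃ᶠ a in atTop, P a) → RiemannHypothesis)`,

both halves of the odd Weil criterion being theorems of the tree (`yoshida_odd_criterion_mp`;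
Summit-side `stub_oddSectorCriterion` + `riemannZeta_ofReal_ne_zero_of_pos_of_lt_one`). Hence
`C ↔ (X → RH)` with `X = OddOneSignedWindows` (first recorded by refuter-rattack in
`Cruxes/OddBartaFloor/OddBartaFloorLogic.lean`; re-derived here through the template), so a
refutation of `C` is a proof of `X ∧ ¬RH`: out of reach of any refuter, computation or barrier.
What an RH-free PROOF of `C` must deliver is exactly (`oddBartaFloor_iff_signChange`):

  `¬RH → ∀ᶠ a in atTop, every odd-sector ground state on [-a,a] CHANGES SIGN on (0,a)`.

## Load-bearing analysis (§2) — the sign clause `0 ≤ Re u` carries ALL the RH-content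

| mutation of `C` | status | theorem |
|---|---|---|
| drop `GoodWindow a` entirely | `↔ RH` | `withoutGoodWindow_iff_rh` (rattack's, via template) |
| keep "window carries an odd bottom state", drop the sign clause | `↔ RH` | `withoutSign_iff_rh` (NEW; existence is LANDED: `exists_isWeilOddGroundState`) |
| keep existence + reality `Im u = 0`, drop `0 ≤ Re u` | `↔ RH` | `withoutNonneg_iff_rh` (NEW; real bottom states are LANDED: `exists_real_of_isWeilOddGroundState`) |
| keep existence + `0 ≤ Re u`, drop reality `Im u = 0` | `↔ RH` | `withoutReality_iff_rh` (NEW; junk witness `u = I·v`, `Re u ≡ 0 ≥ 0`) |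
| drop `Tendsto e atTop (𝓝 0)` | THEOREM | `withoutDecay_holds` (rattack's; `e a := -ε_od(a)`) |
| drop the threshold `a₀` (all windows) | `↔ C` | `allWindows_iff` (NEW; `e` is free below `a₀`) |
| conclusion for ALL tests (any parity/support, unnormalised, floor `0`) | `↔ C` | `allTests_iff` (NEW) |
| conclusion replaced by `RH` itself | `↔ C` | `oddBartaFloor_iff_eventually_good_imp_rh` (NEW) |

So the statement is RIGID: every single-clause mutation is a theorem, or `↔ C`, or `↔ RH`; the
one clause whose removal changes the truth value class is `∀ᵐ t ∈ (0,a), Im u = 0 ∧ 0 ≤ Re u`,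
and BOTH conjuncts of it are needed (`withoutNonneg_iff_rh`, `withoutReality_iff_rh`).

## Mechanism-level small models (§3) — Barta's inequality in `ℝⁿ`

`barta_matrix`: symmetric `A`, eigenpair `A ψ = E ψ` with `ψ ≥ 0`, comparison vector `H` with
`⟨ψ, H⟩ > 0` and `A H ≥ -e H` componentwise ⟹ `E ≥ -e` (the whole mechanism in four lines).
`barta_false_without_sign` (2×2: `A = [[1,2],[2,1]]`, `H = (1,1)`, `AH = (3,3) ≥ 0`, bottom
`ψ = (1,-1)`, `E = -1 < 0`): without one-signedness of `ψ` the supersolution gives NOTHING.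
`barta_false_without_everywhere` (2×2: `A = [[1,-2],[-2,-2]]`, one-signed bottom `ψ = (1,2)`,
`E = -3`, `H = (3,1)`, `(AH)₀ = 1 ≥ 0` but `(AH)₁ = -8`): the pointwise inequality must hold on the
WHOLE support of `ψ` — an edge/origin layer where `T_a ≥ -e H_a` fails is fatal unless the mass
of `ψ` there is controlled (this is the content of 2001 Thm 5.2's "layer-mass bound" in kill
criterion (k2) of the route).

## Numerics (mechanism, RH-free) — prior art and this cycle's independent re-derivation

Prior: rattack `eod_check` (sup D/|Φ′| = 0.0989 / 1.28e-3 / 3.34e-5 at a = 1 / 1.5 / 2, teeth p* = 7,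
19, 53); ideator jobs j023076 / j023090 (min T_a/H_a = -2.48e-2 / -7.24e-2 / -1.11e-3 at
a = .75 / 1 / 1.5) and j023117 (BV vector vs smooth tapers).

THIS CYCLE, job j023789 (`num/trep.py`, mpmath dps 20, from scratch in the tree's normalisation
`Φ(t) = 2Φ_dB(t/2)`, `x = e^{2a}`; `T_a = 𝒫 − D + S + 𝒜` on `(0,a)` with
`𝒫/D = Σ Λ(n)n^{-1/2}|Φ′(t ± log n)|` on `t + log n > a` / `log n − t > a`,
`S = 4 sinh(t/2)∫_a^∞|Φ′|sinh(s/2)`, `𝒜 = ∫_a^∞[w(s−t) − w(s+t)]|Φ′(s)| ds`, `w(r) = e^{-r/2}/(1−e^{-2r})`;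
grid + dyadic edge/origin refinements + every tooth `t_n = log n − a − 10⁻⁹`):

| a | x | min T_a/H_a | at tooth n | D/H there | −min/(a e^{−a}) |
|---|---|---|---|---|---|
| 0.75 | 4.48 | −2.49e−2 | 4 | 4.54e−2 | 0.070 |
| 1.0 | 7.39 | −7.37e−2 | 7 | 9.89e−2 | 0.200 |
| 1.5 | 20.1 | −1.12e−3 | 19 | 1.28e−3 | 0.0033 |
| 2.0 | 54.6 | −2.96e−5 | 53 | 3.34e−5 | 1.1e−4 |
| 2.5 | 148.4 | −8.2e−26 | 139 | 8.6e−26 | 4e−25 |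
| 3.0 | 403.4 | −6.7e−8 | 401 | 7.7e−8 | 4.5e−7 |
| 3.5 | 1096.6 | −2.4e−11 | 1093 | 2.7e−11 | 2.3e−10 |
| 4.0 | 2981.0 | −1.0e−28 | 2971 | 1.1e−28 | 1.4e−27 |

Reading: (i) the three prior values are reproduced to 2–3 digits by an independent code (D/H at
the minimiser matches rattack's sup D/|Φ′| to 3 digits), so the SIGN BOOKKEEPING of the four
pieces is confirmed a third time; (ii) `T_a < 0` happens only at teeth, with magnitude set by the
Diophantine gap `2a − log p*` to the nearest prime power BELOW `x` (`≈ Λ(p*)p*^{-1/2}e^{−2πx(2a−log p*)}`),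
hence wildly non-monotone in `a` (a = 2.5 vs 3.0) and always `≪ (log x)/√x`; (iii) the card
constant `C = 10` in `e(a) = C a e^{−a}` has ≥ 50× room at these generic windows.

ADVERSARIAL (Diophantine worst-case) windows, job j023837: `x = p·e^{δ}` just above a prime power,
`p ∈ {7, 8, 53, 401, 2971, 8192}`, `δ ∈ {10⁻¹, 10⁻², 10⁻³, 10⁻⁴}` (24 windows, same code). Largest
`−min T_a/H_a` per `p`: 1.26e−1 (x = 7.07, δ = 10⁻²), 4.5e−3 (x = 8.00), 1.56e−2 (x = 53.5, δ = 10⁻²),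
1.14e−2 (x = 401.4, δ = 10⁻³), 8.8e−7 (x = 3000.9), 1.0e−5 (x = 8274); normalised
`sup(−T/H)·√x/log x ≤ 0.17` and `sup(−T/H)/(10 a e^{−a}) ≤ 0.34`, `sup(−T/H)/(2.88(2a+1)e^{−a}) ≤ 0.04`
over all 32 windows of both jobs. MECHANISM FINDING: as `δ → 0` the edge tooth does NOT approach
the naive `Λ(p)p^{-1/2} ≈ (log x)/√x` — the positive log-singular archimedean coupling
`𝒜(t) ≈ ½|Φ′(a)|·e^{2πx(a−t)}E₁(2πx(a−t))` at the edge grows like `log(1/(a−t))` and cancels the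
`D`-atom of `p` (at x = 2971.3, δ = 10⁻⁴ the 2971-tooth is no longer even the minimiser); the worst
`δ` is intermediate, `δ ≈ c/(2πx)`. So the cards' edge-regime constants carry ≥ 25× slack, and a
prover may spend `𝒜` (not only its sign) at the edge if the `D`-vs-`H_a` ratio bound gets tight.
None of this can bear on `C` itself (`floorAt_iff`, `allWindows_iff`); it polices the MECHANISM.

`ledger negatives --problem RiemannHypothesis`: 1 unrelated entry (LaplaceLoophole). Barrier
catalogue `Literature/Barriers/RiemannHypothesis/`: no entry can bite an RH-implied statement.

## Targets
None yet (no line picked, payload.targets = []). When a line registers stubs of per-window shape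
`BartaFloorAt C a := GoodWindow a → -(C a e^{-a}) ≤ weilOddGroundEnergy a` (cards
paired-tail-prime-free-floor / cheap-jump-weak-barta), note: that stub is RH-implied too
(`weilOddGroundEnergy_nonneg_of_riemannHypothesis`), hence equally irrefutable; only its
MECHANISM lemmas (`ThetaImageFloor`, `CheapJump`, `OddEulerLagrangeTheta`) are RH-free and
finitely falsifiable — those are the disprover's next targets.
-/

noncomputable section

set_option linter.dupNamespace false

namespace Summit.RiemannHypothesis.RiemannHypothesis.Cruxes.OddBartaFloor.Disproof

open Filter Set MeasureTheory
open scoped Topology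
open Literature.NumberTheory.LFunctions
open Summit.RiemannHypothesis.RiemannHypothesis.Theses.OddSector
open Summit.RiemannHypothesis.RiemannHypothesis.Theorems.OddSector
  (exists_isWeilOddGroundState exists_isWeilOddGroundState_unbounded
    exists_real_of_isWeilOddGroundState)

/-! ## 0. Vocabulary (definitional repackaging of the crux) -/

/-- The sign clause of the crux: `u` is real and `≥ 0` a.e. on the right half-window. -/
def OneSigned (a : ℝ) (u : ℝ → ℂ) : Prop :=
  ∀ᵐ t : ℝ, t ∈ Ioo 0 a → (u t).im = 0 ∧ 0 ≤ (u t).re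

/-- A window is GOOD when it carries a one-signed odd-sector ground state (the hypothesis of the
crux = the `∃ u` clause of `OddOneSignedWindows`). -/
def GoodWindow (a : ℝ) : Prop :=
  ∃ u : ℝ → ℂ, IsWeilOddGroundState a u ∧ OneSigned a u

/-- The conclusion of the crux at window `a` with floor `f`: every `L²`-normalised odd window test
has `Re Q ≥ f`. -/
def OddFloor (a f : ℝ) : Prop :=
  ∀ h : ℝ → ℂ, IsWeilTest h → tsupport h ⊆ Icc (-a) a → (∀ t, h (-t) = -h t) →
    ∫ t, ‖h t‖ ^ 2 = (1 : ℝ) → f ≤ (weilQuadratic h).re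

/-- The FLOOR TEMPLATE over a window predicate `P`: "`∃ e → 0, ∃ a₀, ∀ a ≥ a₀, P a →` floor
`-e a` on the odd sphere of `[-a,a]`". The crux is `FloorAt GoodWindow`. -/
def FloorAt (P : ℝ → Prop) : Prop :=
  ∃ e : ℝ → ℝ, Tendsto e atTop (𝓝 0) ∧ ∃ a₀ : ℝ, ∀ a : ℝ, a₀ ≤ a → P a → OddFloor a (-e a)

/-- The crux IS the template at `GoodWindow` (definitional). -/
theorem oddBartaFloor_iff_floorAt : OddBartaFloor ↔ FloorAt GoodWindow :=
  Iff.rfl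

/-- The thesis crux over the same vocabulary (definitional). -/
theorem oddOneSignedWindows_iff :
    OddOneSignedWindows ↔ ∀ A : ℝ, ∃ a : ℝ, A ≤ a ∧ GoodWindow a :=
  Iff.rfl

/-- The thesis crux says: good windows occur FREQUENTLY at infinity. -/
theorem oddOneSignedWindows_iff_frequently :
    OddOneSignedWindows ↔ ∃ᶠ a in atTop, GoodWindow a := by
  rw [oddOneSignedWindows_iff, Filter.frequently_atTop]

/-- Odd-sector Weil positivity (Yoshida's "oddly positive definite"). -/
def OddPositivity : Prop :=
  ∀ g : ℝ → ℂ, IsWeilTest g → (∀ t, g (-t) = -g t) → 0 ≤ (weilQuadratic g).re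

/-- Odd positivity is the zero floor at every window. -/
theorem oddPositivity_iff_forall_oddFloor : OddPositivity ↔ ∀ a : ℝ, OddFloor a 0 := by
  constructor
  · intro h a g hg _ hodd _
    exact h g hg hodd
  · intro h
    have hε : ∀ a : ℝ, 0 ≤ weilOddGroundEnergy a := fun a ↦ by
      refine Real.sInf_nonneg ?_
      rintro x ⟨g, hg, hs, hodd, hnorm, rfl⟩
      exact h a g hg hs hodd hnorm
    intro g hg hodd
    obtain ⟨a, _, hs⟩ := hg.exists_tsupport_subset_Icc
    exact (weilOddGroundEnergy_nonneg_iff a).1 (hε a) g hg hs hodd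

/-- **Odd positivity IS the Riemann hypothesis, unconditionally in the tree** (hard half:
Summit-side `stub_oddSectorCriterion` — positivity on odd REAL tests already puts every strip
zero on the line or the real axis — plus "no real zeros in `(0,1)`" and the strip form of RH;
easy half: `yoshida_odd_criterion_mp`). -/
theorem oddPositivity_iff_rh : OddPositivity ↔ _root_.RiemannHypothesis := by
  constructor
  · intro hpos
    have hstrip := Theorems.RuelleBandExactFirstBand.stub_oddSectorCriterion
      (fun g hg hodd _ ↦ hpos g hg hodd)
    refine riemannHypothesis_iff_strip_holds.2 fun s hs h0 h1 ↦ ?_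
    rcases hstrip s hs h0 h1 with h | him
    · exact h
    · exfalso
      have hsre : s = ((s.re : ℝ) : ℂ) := by
        apply Complex.ext <;> simp [him]
      rw [hsre] at hs
      exact riemannZeta_ofReal_ne_zero_of_pos_of_lt_one s.re h0 h1 hs
  · intro hRH g hg hodd
    exact yoshida_odd_criterion_mp hRH g hg hodd

/-! ## 1. The template theorem and irrefutability -/

/-- **THE TEMPLATE THEOREM.** For every window predicate `P`,
`FloorAt P ↔ ((∃ᶠ a in atTop, P a) → RH)`.
(→) antitonicity of the window class: a normalised odd test of negative energy on `[-b,b]` lives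
on every larger window, and `P`-windows with `e a` below `-Re Q(h)` exist beyond `max b a₀`.
(←) if `P` is frequent, RH gives the zero floor; if not, `P` fails beyond some `A` and the
statement is vacuous with `a₀ := A`. -/
theorem floorAt_iff (P : ℝ → Prop) :
    FloorAt P ↔ ((∃ᶠ a in atTop, P a) → _root_.RiemannHypothesis) := by
  constructor
  · rintro ⟨e, he, a₀, hfl⟩ hP
    refine oddPositivity_iff_rh.1 (oddPositivity_iff_forall_oddFloor.2 fun b h hh hs hodd hnorm ↦ ?_)
    by_contra hneg
    push Not at hneg
    have hev : ∀ᶠ a in atTop, e a < -(weilQuadratic h).re :=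
      he.eventually (Iio_mem_nhds (by linarith))
    obtain ⟨a, hPa, hea, hba⟩ :=
      (hP.and_eventually (hev.and (eventually_ge_atTop (max b a₀)))).exists
    have hb : b ≤ a := le_trans (le_max_left _ _) hba
    have ha₀ : a₀ ≤ a := le_trans (le_max_right _ _) hba
    have hs' : tsupport h ⊆ Icc (-a) a := hs.trans (Icc_subset_Icc (neg_le_neg hb) hb)
    have h1 := hfl a ha₀ hPa h hh hs' hodd hnorm
    linarith
  · intro H
    by_cases hP : ∃ᶠ a in atTop, P a
    · have hRH := H hP
      exact ⟨fun _ ↦ 0, tendsto_const_nhds, 0, fun a _ _ h hh _ hodd _ ↦ by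
        rw [neg_zero]; exact yoshida_odd_criterion_mp hRH h hh hodd⟩
    · rw [Filter.not_frequently] at hP
      obtain ⟨A, hA⟩ := Filter.eventually_atTop.1 hP
      exact ⟨fun _ ↦ 0, tendsto_const_nhds, A, fun a ha hPa ↦ absurd hPa (hA a ha)⟩

/-- **`C ↔ (X → RH)`** (refuter-rattack's finding, through the template). -/
theorem oddBartaFloor_iff_thesis_imp_rh :
    OddBartaFloor ↔ (OddOneSignedWindows → _root_.RiemannHypothesis) := by
  rw [oddBartaFloor_iff_floorAt, floorAt_iff, ← oddOneSignedWindows_iff_frequently]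

/-- **Irrefutability**: a refutation of the crux is a proof of the thesis AND of `¬RH`. -/
theorem not_oddBartaFloor_iff :
    ¬ OddBartaFloor ↔ (OddOneSignedWindows ∧ ¬ _root_.RiemannHypothesis) := by
  rw [oddBartaFloor_iff_thesis_imp_rh, Classical.not_imp]

/-- `S → C`: RH proves the crux (floor `0`). -/
theorem oddBartaFloor_of_riemannHypothesis (h : _root_.RiemannHypothesis) : OddBartaFloor :=
  oddBartaFloor_iff_thesis_imp_rh.2 fun _ ↦ h

/-- `¬X → C`: a refutation of the thesis crux proves this crux (vacuously). -/
theorem oddBartaFloor_of_not_thesis (h : ¬ OddOneSignedWindows) : OddBartaFloor :=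
  oddBartaFloor_iff_thesis_imp_rh.2 fun hX ↦ absurd hX h

/-- **What an RH-free proof must show.** The crux is equivalent to: if RH fails then, beyond some
height, EVERY odd-sector ground state on `[-a,a]` fails to be one-signed on `(0,a)`. (This is the
contrapositive the Barta mechanism actually proves: `¬RH ⇒ ε_od(∞) < 0 ⇒ ε_od(a) < -e(a)`
eventually `⇒` no one-signed bottom state, by `ε_od(a) ≥ -e(a)` at good windows.) -/
theorem oddBartaFloor_iff_signChange :
    OddBartaFloor ↔
      (¬ _root_.RiemannHypothesis →
        ∀ᶠ a in atTop, ∀ u : ℝ → ℂ, IsWeilOddGroundState a u → ¬ OneSigned a u) := by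
  rw [oddBartaFloor_iff_floorAt, floorAt_iff]
  constructor
  · intro H hRH
    have hnf : ¬ ∃ᶠ a in atTop, GoodWindow a := fun h ↦ hRH (H h)
    rw [Filter.not_frequently] at hnf
    exact hnf.mono fun a ha u hu hs ↦ ha ⟨u, hu, hs⟩
  · intro H hfreq
    by_contra hRH
    obtain ⟨a, ⟨u, hu, hs⟩, hno⟩ := (hfreq.and_eventually (H hRH)).exists
    exact hno u hu hs

/-- The same with the conclusion replaced by RH itself: the crux says "if all large windows that
are good …" nothing more than "`GoodWindow` on a tail of windows is incompatible with `¬RH`". -/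
theorem oddBartaFloor_iff_eventually_good_imp_rh :
    OddBartaFloor ↔ ∃ a₀ : ℝ, ∀ a : ℝ, a₀ ≤ a → GoodWindow a → _root_.RiemannHypothesis := by
  rw [oddBartaFloor_iff_floorAt, floorAt_iff]
  constructor
  · intro H
    by_cases hP : ∃ᶠ a in atTop, GoodWindow a
    · exact ⟨0, fun _ _ _ ↦ H hP⟩
    · rw [Filter.not_frequently] at hP
      obtain ⟨A, hA⟩ := Filter.eventually_atTop.1 hP
      exact ⟨A, fun a ha hPa ↦ absurd hPa (hA a ha)⟩
  · rintro ⟨a₀, H⟩ hfreq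
    obtain ⟨a, hPa, ha⟩ := (hfreq.and_eventually (eventually_ge_atTop a₀)).exists
    exact H a ha hPa

/-! ## 2. Load-bearing analysis: one clause mutated at a time -/

/-- Mutation 1: the hypothesis `GoodWindow a` DROPPED. -/
def OddBartaFloorWithoutGoodWindow : Prop :=
  FloorAt fun _ ↦ True

/-- **Dropping `GoodWindow` gives RH itself** (rattack's `oddBartaFloorWithoutGoodWindow_iff_rh`,
now a one-line instance of the template). -/
theorem withoutGoodWindow_iff_rh : OddBartaFloorWithoutGoodWindow ↔ _root_.RiemannHypothesis :=
  (floorAt_iff _).trans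
    ⟨fun h ↦ h (Filter.Eventually.frequently (Filter.Eventually.of_forall fun _ ↦ trivial)),
      fun h _ ↦ h⟩

/-- Mutation 2: the SIGN CLAUSE dropped — the window is only asked to carry SOME odd-sector
ground state. -/
def OddBartaFloorWithoutSign : Prop :=
  FloorAt fun a ↦ ∃ u : ℝ → ℂ, IsWeilOddGroundState a u

/-- **Dropping only the sign clause ALREADY gives RH**: odd-sector ground states exist at every
window `a > 0` (LANDED: `exists_isWeilOddGroundState`, Bombieri 2000 Thm 3 in the odd sector via
Connes–Consani–Moscovici compactness), so the mutated hypothesis is frequent and the template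
collapses to RH. The ENTIRE RH-content of the crux sits in `OneSigned a u`. -/
theorem withoutSign_iff_rh : OddBartaFloorWithoutSign ↔ _root_.RiemannHypothesis :=
  (floorAt_iff _).trans
    ⟨fun h ↦ h (Filter.frequently_atTop.2 fun A ↦ by
        obtain ⟨a, ha, u, hu⟩ := exists_isWeilOddGroundState_unbounded A
        exact ⟨a, ha, u, hu⟩),
      fun h _ ↦ h⟩

/-- Mutation 3: the nonnegativity `0 ≤ Re u` dropped, reality `Im u = 0` on `(0,a)` kept. -/
def OddBartaFloorWithoutNonneg : Prop :=
  FloorAt fun a ↦ ∃ u : ℝ → ℂ, IsWeilOddGroundState a u ∧ ∀ᵐ t : ℝ, t ∈ Ioo 0 a → (u t).im = 0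

/-- **Dropping `0 ≤ Re u` (keeping reality) gives RH**: every window `a > 0` carries a REAL odd-sector
ground state (LANDED: `exists_real_of_isWeilOddGroundState` — normalised real or imaginary part). -/
theorem withoutNonneg_iff_rh : OddBartaFloorWithoutNonneg ↔ _root_.RiemannHypothesis :=
  (floorAt_iff _).trans
    ⟨fun h ↦ h (Filter.frequently_atTop.2 fun A ↦ by
        obtain ⟨a, ha, u, hu⟩ := exists_isWeilOddGroundState_unbounded A
        obtain ⟨v, hv, hreal⟩ := exists_real_of_isWeilOddGroundState hu
        exact ⟨a, ha, v, hv, Filter.Eventually.of_forall fun t _ ↦ hreal t⟩),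
      fun h _ ↦ h⟩

/-- Mutation 4: the reality `Im u = 0` dropped, nonnegativity `0 ≤ Re u` on `(0,a)` kept. -/
def OddBartaFloorWithoutReality : Prop :=
  FloorAt fun a ↦ ∃ u : ℝ → ℂ, IsWeilOddGroundState a u ∧ ∀ᵐ t : ℝ, t ∈ Ioo 0 a → 0 ≤ (u t).re

/-- **Dropping `Im u = 0` (keeping `0 ≤ Re u`) gives RH** — by a JUNK witness: for a real ground
state `v`, `u := I·v` is a ground state (phase invariance `IsWeilOddGroundState.const_mul`) with
`Re u ≡ 0 ≥ 0`. So the reality conjunct is load-bearing as well: without it the sign clause is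
vacuous. -/
theorem withoutReality_iff_rh : OddBartaFloorWithoutReality ↔ _root_.RiemannHypothesis :=
  (floorAt_iff _).trans
    ⟨fun h ↦ h (Filter.frequently_atTop.2 fun A ↦ by
        obtain ⟨a, ha, u, hu⟩ := exists_isWeilOddGroundState_unbounded A
        obtain ⟨v, hv, hreal⟩ := exists_real_of_isWeilOddGroundState hu
        refine ⟨a, ha, fun t ↦ Complex.I * v t, hv.const_mul (by simp), ?_⟩
        exact Filter.Eventually.of_forall fun t _ ↦ by simp [Complex.mul_re, hreal t]),
      fun h _ ↦ h⟩

/-- Mutation 5: the decay `Tendsto e atTop (𝓝 0)` dropped — then the statement is a THEOREM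
(rattack): take `e a := -ε_od(a)`, the odd sphere being bounded below. -/
theorem withoutDecay_holds :
    ∃ e : ℝ → ℝ, ∃ a₀ : ℝ, ∀ a : ℝ, a₀ ≤ a → GoodWindow a → OddFloor a (-e a) :=
  ⟨fun a ↦ -weilOddGroundEnergy a, 0, fun a _ _ h hh hs hodd hnorm ↦ by
    rw [neg_neg]; exact weilOddGroundEnergy_le hh hs hodd hnorm⟩

/-- Mutation 6: the threshold `a₀` dropped (floor claimed at EVERY good window). -/
def OddBartaFloorAllWindows : Prop :=
  ∃ e : ℝ → ℝ, Tendsto e atTop (𝓝 0) ∧ ∀ a : ℝ, GoodWindow a → OddFloor a (-e a)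

/-- **Dropping `a₀` changes nothing**: `e` is unconstrained on any bounded set of windows, so one
patches `e := -ε_od` below `a₀`. (Hence no finite set of windows — and no computation — can ever
bear on the crux.) -/
theorem allWindows_iff : OddBartaFloorAllWindows ↔ OddBartaFloor := by
  rw [oddBartaFloor_iff_floorAt]
  constructor
  · rintro ⟨e, he, hfl⟩
    exact ⟨e, he, 0, fun a _ ↦ hfl a⟩
  · rintro ⟨e, he, a₀, hfl⟩
    refine ⟨fun a ↦ if a₀ ≤ a then e a else -weilOddGroundEnergy a, ?_, fun a hgood ↦ ?_⟩
    · refine he.congr' ?_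
      filter_upwards [eventually_ge_atTop a₀] with a ha
      rw [if_pos ha]
    · by_cases ha : a₀ ≤ a
      · simpa only [if_pos ha] using hfl a ha hgood
      · intro h hh hs hodd hnorm
        simp only [if_neg ha, neg_neg]
        exact weilOddGroundEnergy_le hh hs hodd hnorm

/-- Mutation 7: the conclusion strengthened to Weil positivity on ALL tests (even or odd, any
support, unnormalised, floor `0`). -/
def OddBartaFloorAllTests : Prop :=
  ∃ a₀ : ℝ, ∀ a : ℝ, a₀ ≤ a → GoodWindow a → WeilPositivity

/-- **Oddness / support / normalisation / the `-e(a)` slack in the conclusion are all decoration**: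
the all-tests zero-floor version is equivalent to the crux (if good windows are frequent the crux
gives RH, whence full Weil positivity by `weil_criterion_holds`; if not, both are vacuous). -/
theorem allTests_iff : OddBartaFloorAllTests ↔ OddBartaFloor := by
  rw [oddBartaFloor_iff_eventually_good_imp_rh]
  constructor
  · rintro ⟨a₀, H⟩
    exact ⟨a₀, fun a ha hgood ↦ weil_criterion_holds.2 (H a ha hgood)⟩
  · rintro ⟨a₀, H⟩
    exact ⟨a₀, fun a ha hgood ↦ weil_criterion_holds.1 (H a ha hgood)⟩

/-- For the record: `GoodWindow a → 0 < a` (degenerate windows carry no ground state), so the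
junk regime `a ≤ 0` never meets the hypothesis. -/
theorem GoodWindow.pos {a : ℝ} (h : GoodWindow a) : 0 < a := by
  obtain ⟨u, hu, _⟩ := h
  exact hu.pos

/-- For the record: either sign will do — `GoodWindow a` iff some REAL odd ground state is `≥ 0`
OR `≤ 0` a.e. on `(0,a)` (pass to `-u`, `IsWeilOddGroundState.neg`). -/
theorem goodWindow_iff_real_oneSigned_either {a : ℝ} :
    GoodWindow a ↔ ∃ u : ℝ → ℂ, IsWeilOddGroundState a u ∧
      (∀ᵐ t : ℝ, t ∈ Ioo 0 a → (u t).im = 0) ∧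
      ((∀ᵐ t : ℝ, t ∈ Ioo 0 a → 0 ≤ (u t).re) ∨ (∀ᵐ t : ℝ, t ∈ Ioo 0 a → (u t).re ≤ 0)) := by
  constructor
  · rintro ⟨u, hu, hs⟩
    exact ⟨u, hu, hs.mono fun t ht hta ↦ (ht hta).1, Or.inl (hs.mono fun t ht hta ↦ (ht hta).2)⟩
  · rintro ⟨u, hu, hreal, hsign | hsign⟩
    · exact ⟨u, hu, (hreal.and hsign).mono fun t ht hta ↦ ⟨ht.1 hta, ht.2 hta⟩⟩
    · refine ⟨fun t ↦ -u t, hu.neg, (hreal.and hsign).mono fun t ht hta ↦ ⟨?_, ?_⟩⟩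
      · simp [ht.1 hta]
      · have := ht.2 hta
        simp only [Complex.neg_re]
        linarith

/-! ## 3. Mechanism-level small models: Barta's inequality in `ℝⁿ` -/

open Matrix in
/-- **Barta's inequality, finite-dimensional model of the route's mechanism.** For a symmetric
matrix `A`, an eigenpair `A ψ = E ψ` with `ψ ≥ 0`, and a comparison vector `H` with `⟨ψ,H⟩ > 0`
satisfying the supersolution inequality `A H ≥ -e H` componentwise, the eigenvalue obeys
`E ≥ -e`. (Route: `A = A_a` on the odd sector of the window, `ψ` = one-signed odd bottom state,
`H = H_a = -Φ′𝟙_{[-a,a]}`, `E = ε_od(a)`.) -/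
theorem barta_matrix {ι : Type*} [Fintype ι] (A : Matrix ι ι ℝ) (hA : A.IsSymm)
    {ψ H : ι → ℝ} {E e : ℝ} (hψ : A *ᵥ ψ = E • ψ) (hψ0 : ∀ i, 0 ≤ ψ i)
    (hpair : 0 < ψ ⬝ᵥ H) (hsuper : ∀ i, -e * H i ≤ (A *ᵥ H) i) : -e ≤ E := by
  have h1 : ψ ⬝ᵥ (A *ᵥ H) = E * (ψ ⬝ᵥ H) := by
    rw [dotProduct_mulVec, ← mulVec_transpose, hA.eq, hψ, smul_dotProduct, smul_eq_mul]
  have h2 : -e * (ψ ⬝ᵥ H) ≤ ψ ⬝ᵥ (A *ᵥ H) := by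
    simp only [dotProduct, Finset.mul_sum]
    refine Finset.sum_le_sum fun i _ ↦ ?_
    have := mul_le_mul_of_nonneg_left (hsuper i) (hψ0 i)
    linarith
  rw [h1] at h2
  exact le_of_mul_le_mul_right h2 hpair

open Matrix in
/-- **The sign hypothesis is load-bearing for the mechanism** (2×2 model): a symmetric `A` with a
positive comparison vector `H`, `A H ≥ 0 = -0·H`, whose bottom eigenvector `ψ = (1,-1)` is NOT
one-signed and whose bottom eigenvalue `E = -1` violates the would-be floor `E ≥ 0`. -/
theorem barta_false_without_sign :
    ∃ (A : Matrix (Fin 2) (Fin 2) ℝ) (ψ H : Fin 2 → ℝ) (E : ℝ),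
      A.IsSymm ∧ A *ᵥ ψ = E • ψ ∧ ψ ≠ 0 ∧ (∀ i, 0 < H i) ∧ (∀ i, -0 * H i ≤ (A *ᵥ H) i) ∧
        E < -0 := by
  refine ⟨!![1, 2; 2, 1], ![1, -1], ![1, 1], -1, ?_, ?_, ?_, ?_, ?_, by norm_num⟩
  · exact Matrix.IsSymm.ext fun i j ↦ by fin_cases i <;> fin_cases j <;> rfl
  · ext i; fin_cases i <;> simp [Matrix.mulVec, dotProduct, Fin.sum_univ_two] <;> norm_num
  · intro h; simpa using congr_fun h 0
  · intro i; fin_cases i <;> simp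
  · intro i; fin_cases i <;> simp [Matrix.mulVec, dotProduct, Fin.sum_univ_two] <;> norm_num

open Matrix in
/-- **The supersolution inequality must hold on the WHOLE support of `ψ`** (2×2 model): symmetric
`A = [[1,-2],[-2,-2]]` has the ONE-SIGNED bottom eigenvector `ψ = (1,2)`, `E = -3`; the positive
comparison vector `H = (3,1)` satisfies `(A H)₀ = 1 ≥ 0` but `(A H)₁ = -8 < 0`, and the would-be
floor `E ≥ -0` fails. In the route: an edge or origin layer of `(0,a)` where `T_a ≥ -e H_a` fails
is fatal unless the mass of the bottom state there is separately controlled. -/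
theorem barta_false_without_everywhere :
    ∃ (A : Matrix (Fin 2) (Fin 2) ℝ) (ψ H : Fin 2 → ℝ) (E : ℝ),
      A.IsSymm ∧ A *ᵥ ψ = E • ψ ∧ (∀ i, 0 < ψ i) ∧ (∀ i, 0 < H i) ∧
        -0 * H 0 ≤ (A *ᵥ H) 0 ∧ E < -0 := by
  refine ⟨!![1, -2; -2, -2], ![1, 2], ![3, 1], -3, ?_, ?_, ?_, ?_, ?_, by norm_num⟩
  · exact Matrix.IsSymm.ext fun i j ↦ by fin_cases i <;> fin_cases j <;> rfl
  · ext i; fin_cases i <;> simp [Matrix.mulVec, dotProduct, Fin.sum_univ_two] <;> norm_num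
  · intro i; fin_cases i <;> simp
  · intro i; fin_cases i <;> simp
  · simp [Matrix.mulVec, dotProduct, Fin.sum_univ_two]; norm_num

/-! ## 4. Targets
None registered yet (no line picked). -/

end Summit.RiemannHypothesis.RiemannHypothesis.Cruxes.OddBartaFloor.Disproof

end
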